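import Summits.BirchSwinnertonDyer.Rank1Residual.GaloisImage.KolyvaginDerivativeSingularValue
import Summits.BirchSwinnertonDyer.Rank1Residual.GaloisImage.KolyvaginTransverseCocycle
import HarnessLib

/-!
# K6 crux `MuTransferX9` (stmt-BirchSwinnertonDyer-19276), skeleton v5 stub `stub_stepsTwoFourX9`:
# MU-TRANSFER-PROOF §3 LEMMA 2 for a SINGLE tame prime in the twisted-coefficient setting —
# the Kolyvagin class `κ_q ∈ H¹(G, X)` from the norm relation `𝒩 z̄_q = 0` in `H¹(N, X)`, with its
# cocycle, its value at the tame generator, and its transversality data (continuous `H¹`, class +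
# cocycle level), assembled from the b2b-bsdres derivative library (`GaloisImage.Derivative`)

Cell `bsd-smallim`, seat `bsd-smallim-k6-g3` (gen 0).  THEOREMS ONLY (no definition, no named fact,
no `sorry`); generic continuous group cohomology (`X : TopRep R G`, `N ⊴ G` open), curve-free.
HONEST FRAMING: a helper toward the registered stub `stub_stepsTwoFourX9` of crux 19276 (the Λ-adic
Kolyvagin class `κ_q` of MU-TRANSFER-PROOF §3 / §5 STEP 3); it closes nothing.  PARTITION (D-0054):
X9 (A4) — helper; closes NONE.

## Why this shape (MU-TRANSFER-PROOF §3, KOLY-MEMO Lemma 5.6.2; CORE-PLAN S4.4)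

In the μ-transfer the Kolyvagin class is built over `Ω = Λ/p` at ONE `E`-split prime `q`:
`G = Γ_ℚ ⊇ N = Gal(ℚ̄/ℚ(μ_q))`, `G/N = ⟨σ̄⟩` cyclic of order `n = q − 1 ≡ 0 (mod p)`, coefficients
`X = 𝒯_J = E[p] ⊗ 𝔽_p[T]/T^J(χ)` (`W.modPTwist p κ J`) on which `σ` (a tame inertia generator)
acts trivially and which has NO `N`-fixed vector ((F1): `ℚ(μ_q)` is abelian).  The one input is
the norm relation `cor_{K/ℚ} 𝐳̄_q = P·𝐳̄_1` REDUCED MODULO `T^J` (`J = 2e`), where the Euler factor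
`P = (1 − g⁻¹)² ∈ T^{2e}Ω` VANISHES: so in `H¹(N, 𝒯_J)` the class `ξ = 𝐳̄_q mod T^J` has
`𝒩ξ := Σ_{i<n} σ^i·ξ = res(cor ξ) = 0`.  The descent of `Dξ = Σ i σ^i·ξ` is then NOT the
invertible-index descent of `ConjugationDescent.lean` (`n` kills `X`) but the `X^N = 0` descent of
the b2b-bsdres library (`Derivative.existsUnique_resSubgroup_eq_of_forall_conjMap_eq`,
`Derivative.exists_extend_of_forall_conjMap_eq`), and the VALUE `κ_q(σ) = −t_N` of the memo is
`Derivative.apply_eq_neg_of_norm_eq_coboundary` ([PerrinRiou98] §3.1.2 "`f(σ̃) = −σ̃a`").  This file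
packages exactly that single-prime situation, class level in, class + cocycle level out:

* §1 `exists_norm_witness_of_sum_conjMap_eq_resSubgroup` / `_eq_zero` — from the CLASS identity
  `Σ_{i<n} σ^i·[y] = res [ψ]` (resp. `= 0`) in `H¹(N, X)`, a norm witness ON THE NOSE:
  `Σ_{i<n} σ^i y(σ^{-i} u σ^i) = ψ(u) + (u a − a)` on `N`;
  `sum_conjMap_pow_eq_resSubgroup_cores` — `Σ_{i<n} σ^i· = res ∘ cor` on `H¹(N, X)` when the
  `σ^i`, `i < n`, represent `G/N` (b2b hypotheses `hcov`/`hinj`), so that `𝒩ξ = 0` is the reduced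
  norm relation `res (cor ξ) = 0`.
* §2 `exists_derivCocycle` — the derivative cocycle `Ψ = Σ_{i<n} i • σ^i·y` as a term, its values
  and its class `Σ i • σ^i·[y]`.
* §3 **`exists_kolyvaginCocycle`** — for `N` open, `X^N = 0`, `σ` acting trivially on `X` with
  `σ^n ∈ N`, `G = ⋃ σ^i N`, `n·X = 0`, a cocycle `y` on `N` with `y(σ^n) = 0` and a norm witness
  `a` (`𝒩y = ∂a`): a GLOBAL continuous cocycle `Φ` with `Φ|_N = Ψ`, **`Φ(σ) = −a`**,
  `res [Φ] = Σ i • σ^i·[y]`, and `[Φ]` the UNIQUE class with that restriction (MU-TRANSFER-PROOF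
  Lemma 2: existence, uniqueness, "`κ̃(σ) = −t_N`").
* §4 transversality data: `derivCocycle_apply_eq_sum_smul` (`Φ(Fr) = (Σ_{i<n} i) • y(Fr)` when `y`
  kills the inertial commutators `Fr⁻¹σ^{-i}Frσ^i` — the memo's `κ̃(Fr) = C(n,2)·t_q`),
  `derivCocycle_apply_eq_zero` (`Φ(τ) = 0` when `y` kills the `σ^{-i}τσ^i`), `apply_eq_zero_of_mem_closure`
  / `apply_eq_zero_of_mem_topologicalClosure` / `resSubgroup_eq_zero_of_forall_apply_eq_zero`
  (a cocycle vanishing on generators vanishes on the closed subgroup they generate, and its class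
  restricts to `0` there: `loc_q κ_q ∈ H¹_tr`), `apply_eq_zero_of_resLe_inf_eq_zero` (a class
  unramified at `𝔔` has cocycles vanishing identically on `ℐ_𝔔 ∩ N` when `ℐ_𝔔` acts trivially).
* §5 `rho_sub_eq_of_norm_witness` — the memo's (3.1) at `h = Fr`: from
  `𝒩y = w + ∂a` on `N` and the tame relation, `(ρ(Fr) − 1) a = n • y(Fr) − w(Fr)` — the input of the
  DIVISION step `t_N = −u_P φ̃⁻¹Q(φ̃⁻¹) t_1` (done at level `J' ≥ 3e` in the twisted arithmetic of
  `𝒯_J`, not here); `norm_witness_map` — norm witnesses push forward along an equivariant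
  coefficient map (the truncation `𝒯_{J'} → 𝒯_J`, which kills `P`).

What is NOT here (by name, for the assembler of `stub_stepsTwoFourX9`): the production of `ξ`
from the genuine `IsEulerSystemClass` (reduction `Kato2004.IwasawaH1Data.red` + a Shapiro map
RELATIVE to `K = ℚ(μ_q)` + `IsEulerSystem.cores_cons` through
`Derivative.sum_conjMap_pow_red_eq_aeval`), the identification `P((1+S)^{κ̄(Fr)}) = unit · S^{2e}` on
`𝒯_{pe}`, the division step, and the translation of `Φ(σ)` / `res_{𝒟∩N}[Φ] = 0` into koly's local
currency (`…X9LocalTransverse(Value)`).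

References: HOME/koly/MU-TRANSFER-PROOF.md §3 (Lemma 2), §5 STEP 3; K. Rubin, *Euler Systems*
(2000) §4.4 (Def. 4.4.4, Lemma 4.4.2) [Rubin2000]; B. Perrin-Riou, Ann. Inst. Fourier 48 (1998)
§3.1.2 [PerrinRiou1998AIF]; J.-P. Serre, *Galois Cohomology* (1997) I §2.6 (b)
[SerreGaloisCohomology1997]; tree `Summits/BirchSwinnertonDyer/Rank1Residual/GaloisImage/
KolyvaginDerivative{Descent,CocycleWitnesses,SingularValue}.lean`, `KolyvaginTransverseCocycle.lean`
(cell b2b-bsdres, team n1011, row T-DER).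
-/

-- the summit and its single problem are both named `BirchSwinnertonDyer` (registry layout D-0017)
set_option linter.dupNamespace false
set_option autoImplicit false

noncomputable section

open CategoryTheory Function Finset
open Literature.NumberTheory.GaloisRepresentations
open Literature.NumberTheory.EllipticCurves (subgroupConj subgroupConj_apply_coe)
open Summit.BirchSwinnertonDyer.Rank1Residual.GaloisImage
open Summit.BirchSwinnertonDyer.Rank1Residual.GaloisImage.Derivative
open Summit.BirchSwinnertonDyer.Rank1Residual.GaloisImage.Derivative.Transverse

universe u v

namespace Summit.BirchSwinnertonDyer.BirchSwinnertonDyer.Rank1Residual.KolyvaginTwist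

variable {R : Type v} [CommRing R] [TopologicalSpace R]
variable {G : Type u} [Group G] [TopologicalSpace G] [IsTopologicalGroup G]
variable (X : TopRep.{u} R G) (N : Subgroup G) [N.Normal]

/-! ### §1 From the class-level norm relation to a norm witness on the nose -/

/-- **Norm witness from a class identity.**  If `Σ_{i<n} σ^i·[y] = res [ψ]` in `H¹(N, X)` for a
cocycle `y` on `N` and a global cocycle `ψ` (e.g. `res (cor [y]) = res [ψ]`), then there is
`a ∈ X` with `Σ_{i<n} σ^i y(σ^{-i} u σ^i) = ψ(u) + (u a − a)` for all `u ∈ N` (the memo's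
normalisation "`𝒩w_q = P w_1 + ι(t_N)`", at cocycle level). [cite: Rubin2000, Lemma 4.4.2 (proof)] -/
theorem exists_norm_witness_of_sum_conjMap_eq_resSubgroup (σ : G) (n : ℕ)
    (y : contOneCocycles (subgroupRep X N)) (ψ : contOneCocycles X)
    (h : ∑ i ∈ range n, conjMap X N (σ ^ i) 1 (oneCocycleClass _ y) =
      resSubgroup X N 1 (oneCocycleClass X ψ)) :
    ∃ a : X, ∀ u : N, ∑ i ∈ range n, X.ρ (σ ^ i) (y.1 (subgroupConj N (σ ^ i) u)) =
      ψ.1 u + (X.ρ (u : G) a - a) := by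
  have hsum : oneCocycleClass _ (∑ i ∈ range n,
        contOneCocycles.pullback (subgroupConj N (σ ^ i)) (conjRepHom X N (σ ^ i)) y) =
      ∑ i ∈ range n, conjMap X N (σ ^ i) 1 (oneCocycleClass _ y) := by
    rw [← oneCocycleClassₗ_apply, map_sum]
    exact sum_congr rfl fun i _ => by rw [oneCocycleClassₗ_apply, conjMap_oneCocycleClass]
  rw [← hsum, resSubgroup_oneCocycleClass, ← sub_eq_zero, ← oneCocycleClass_sub,
    oneCocycleClass_eq_zero_iff] at h
  obtain ⟨a, ha⟩ := h
  refine ⟨a, fun u => ?_⟩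
  have hu := ha u
  rw [Submodule.coe_sub, ContinuousMap.sub_apply, sum_apply_val', resSubgroup_pullback_apply,
    subgroupRep_ρ_apply, sub_eq_iff_eq_add'] at hu
  exact (sum_congr rfl fun i _ => rfl).trans hu

/-- **Norm witness from `𝒩[y] = 0`**: if `Σ_{i<n} σ^i·[y] = 0` in `H¹(N, X)` then
`Σ_{i<n} σ^i y(σ^{-i} u σ^i) = u a − a` on `N` for some `a ∈ X` — the hypothesis `hcor` of
`Derivative.rho_apply_deriv_sub_eq`. [cite: PerrinRiou1998AIF, §3.1.2] -/
theorem exists_norm_witness_of_sum_conjMap_eq_zero (σ : G) (n : ℕ)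
    (y : contOneCocycles (subgroupRep X N))
    (h : ∑ i ∈ range n, conjMap X N (σ ^ i) 1 (oneCocycleClass _ y) = 0) :
    ∃ a : X, ∀ u : N, ∑ i ∈ range n, X.ρ (σ ^ i) (y.1 (subgroupConj N (σ ^ i) u)) =
      X.ρ (u : G) a - a := by
  have h' : ∑ i ∈ range n, conjMap X N (σ ^ i) 1 (oneCocycleClass _ y) =
      resSubgroup X N 1 (oneCocycleClass X 0) := by
    rw [h, oneCocycleClass_zero, map_zero]
  obtain ⟨a, ha⟩ := exists_norm_witness_of_sum_conjMap_eq_resSubgroup X N σ n y 0 h'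
  exact ⟨a, fun u => by rw [ha u, Submodule.coe_zero, ContinuousMap.zero_apply, zero_add]⟩

/-- **`Σ_{i<n} σ^i· = res ∘ cor` on `H¹(N, X)`** when the powers `σ^i` (`i < n`) form a system of
representatives of `G ⧸ N` (`hcov`: every coset is some `σ^i N`; `hinj`: at most once) — the
tree's `resSubgroup_cores_eq_sum` along the transversal `i ↦ σ^i`.  So the reduced norm relation
`res (cor ξ) = 0` reads `Σ_{i<n} σ^i·ξ = 0`. [cite: Rubin2000, Lemma 4.4.2 (proof)] -/
theorem sum_conjMap_pow_eq_resSubgroup_cores [Fintype (G ⧸ N)] (hN : IsOpen (N : Set G))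
    {σ : G} {n : ℕ} (hcov : ∀ g : G, ∃ i < n, (σ ^ i)⁻¹ * g ∈ N)
    (hinj : ∀ i₁ < n, ∀ i₂ < n, (σ ^ i₁)⁻¹ * σ ^ i₂ ∈ N → i₁ = i₂)
    (ξ : continuousCohomology 1 (subgroupRep X N)) :
    ∑ i ∈ range n, conjMap X N (σ ^ i) 1 ξ = resSubgroup X N 1 (cores X N hN ξ) := by
  classical
  -- the transversal `i ↦ σ^i` of `G ⧸ N`
  let e : Fin n → G ⧸ N := fun i => QuotientGroup.mk (σ ^ (i : ℕ))
  have he_inj : Function.Injective e := by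
    intro i₁ i₂ h12
    exact Fin.ext (hinj i₁ i₁.2 i₂ i₂.2 (QuotientGroup.eq.mp h12))
  have he_surj : Function.Surjective e := by
    intro x
    obtain ⟨g, rfl⟩ := QuotientGroup.mk_surjective x
    obtain ⟨i, hi, hig⟩ := hcov g
    exact ⟨⟨i, hi⟩, QuotientGroup.eq.mpr hig⟩
  let eE : Fin n ≃ G ⧸ N := Equiv.ofBijective e ⟨he_inj, he_surj⟩
  let s : G ⧸ N → G := fun x => σ ^ ((eE.symm x : Fin n) : ℕ)
  have hs : ∀ x, (s x : G ⧸ N) = x := fun x => by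
    change e (eE.symm x) = x
    exact eE.apply_symm_apply x
  rw [resSubgroup_cores_eq_sum X N hN hs ξ,
    ← Fin.sum_univ_eq_sum_range (fun i => conjMap X N (σ ^ i) 1 ξ), ← eE.sum_comp]
  refine sum_congr rfl fun i _ => ?_
  change conjMap X N (σ ^ (i : ℕ)) 1 ξ = conjMap X N (σ ^ ((eE.symm (eE i) : Fin n) : ℕ)) 1 ξ
  rw [Equiv.symm_apply_apply]

/-! ### §2 The derivative cocycle `Ψ = Σ_{i<n} i • σ^i·y` -/

/-- **The derivative cocycle as a term.**  For a cocycle `y` on `N`, the cocycle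
`Ψ = Σ_{i<n} i • (σ^i·y)` on `N` has values `Ψ(u) = Σ_{i<n} i • σ^i y(σ^{-i} u σ^i)` and class
`Σ_{i<n} i • σ^i·[y]` (Kolyvagin's `D_σ = Σ i σ^i`). [cite: Rubin2000, Def. 4.4.1] -/
theorem exists_derivCocycle (σ : G) (n : ℕ) (y : contOneCocycles (subgroupRep X N)) :
    ∃ Ψ : contOneCocycles (subgroupRep X N),
      (∀ u : N, Ψ.1 u = ∑ i ∈ range n, (i : ℤ) • X.ρ (σ ^ i) (y.1 (subgroupConj N (σ ^ i) u))) ∧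
      oneCocycleClass _ Ψ = ∑ i ∈ range n, i • conjMap X N (σ ^ i) 1 (oneCocycleClass _ y) := by
  refine ⟨∑ i ∈ range n, (i : R) •
      contOneCocycles.pullback (subgroupConj N (σ ^ i)) (conjRepHom X N (σ ^ i)) y,
    fun u => ?_, ?_⟩
  · rw [sum_apply_val']
    refine sum_congr rfl fun i _ => ?_
    rw [Submodule.coe_smul, ContinuousMap.smul_apply, conj_pullback_apply, Nat.cast_smul_eq_nsmul,
      natCast_zsmul]
  · rw [← oneCocycleClassₗ_apply, map_sum]
    refine sum_congr rfl fun i _ => ?_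
    rw [map_smul, oneCocycleClassₗ_apply, conjMap_oneCocycleClass, Nat.cast_smul_eq_nsmul]

/-! ### §3 The Kolyvagin class: existence, uniqueness, cocycle, value at `σ` -/

/-- **Invariance under one generator suffices**: if `G = ⋃_i σ^i N` (`hgen`) and `σ·z = z` in
`H¹(N, X)`, then `g·z = z` for every `g ∈ G` (`N` acts trivially, `conjMap` is multiplicative).
[cite: SerreGaloisCohomology1997, I §2.6 (b)] -/
theorem forall_conjMap_eq_of_conjMap_eq {σ : G} (hgen : ∀ g : G, ∃ i : ℕ, (σ ^ i)⁻¹ * g ∈ N)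
    (z : continuousCohomology 1 (subgroupRep X N)) (hz : conjMap X N σ 1 z = z) (g : G) :
    conjMap X N g 1 z = z := by
  have hpow : ∀ i : ℕ, conjMap X N (σ ^ i) 1 z = z := by
    intro i
    induction i with
    | zero => rw [pow_zero]; exact conjMap_one_one X N z
    | succ i ih => rw [pow_succ', ← conjMap_conjMap, ih, hz]
  obtain ⟨i, hi⟩ := hgen g
  have e : g = σ ^ i * ((σ ^ i)⁻¹ * g) := by group
  rw [e, ← conjMap_conjMap, conjMap_eq_self_of_mem_one X N hi, hpow]

/-- **MU-TRANSFER-PROOF §3 LEMMA 2 (single tame prime, generic continuous `H¹`).**  Let `N ⊴ G` be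
open with `X^N = 0`, `σ ∈ G` acting trivially on `X` with `σ^n ∈ N` and `G = ⋃_i σ^i N`, `n·X = 0`;
let `y` be a cocycle on `N` with `y(σ^n) = 0` (the class is unramified at the prime where `σ` is
inertial) and `a ∈ X` a norm witness, `Σ_{i<n} σ^i y(σ^{-i} u σ^i) = u a − a` on `N` (`𝒩[y] = 0`,
§1).  THEN there is a global continuous cocycle `Φ` (a cocycle of the Kolyvagin class `κ`) with:
`Φ|_N = Σ_{i<n} i • σ^i·y` (the derivative cocycle), **`Φ(σ) = −a`** (the memo's
`κ̃(σ) = −t_N`), `res [Φ] = Σ_{i<n} i • σ^i·[y] = D[y]`, and `[Φ]` is the ONLY class of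
`H¹(G, X)` restricting to `D[y]`.  Assembled from the b2b-bsdres library:
`Derivative.rho_apply_deriv_sub_eq`, `Derivative.exists_extend_of_forall_conjMap_eq`,
`Derivative.apply_eq_neg_of_norm_eq_coboundary`,
`Derivative.existsUnique_resSubgroup_eq_of_forall_conjMap_eq`.
[cite: PerrinRiou1998AIF, §3.1.2] -/
theorem exists_kolyvaginCocycle (hN : IsOpen (N : Set G))
    (h0 : ∀ v : X, (∀ u : N, X.ρ (u : G) v = v) → v = 0)
    {σ : G} (hσ : ∀ w : X, X.ρ σ w = w) {n : ℕ} (hσn : σ ^ n ∈ N)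
    (hgen : ∀ g : G, ∃ i : ℕ, (σ ^ i)⁻¹ * g ∈ N) (hnX : ∀ w : X, (n : ℤ) • w = 0)
    (y : contOneCocycles (subgroupRep X N)) (hyσ : y.1 ⟨σ ^ n, hσn⟩ = 0) (a : X)
    (hcor : ∀ u : N, ∑ i ∈ range n, X.ρ (σ ^ i) (y.1 (subgroupConj N (σ ^ i) u)) =
      X.ρ (u : G) a - a) :
    ∃ Φ : contOneCocycles X,
      (∀ u : N, Φ.1 u = ∑ i ∈ range n, (i : ℤ) • X.ρ (σ ^ i) (y.1 (subgroupConj N (σ ^ i) u))) ∧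
      Φ.1 σ = -a ∧
      resSubgroup X N 1 (oneCocycleClass X Φ) =
        ∑ i ∈ range n, i • conjMap X N (σ ^ i) 1 (oneCocycleClass _ y) ∧
      ∀ κ : continuousCohomology 1 X,
        resSubgroup X N 1 κ = ∑ i ∈ range n, i • conjMap X N (σ ^ i) 1 (oneCocycleClass _ y) →
          κ = oneCocycleClass X Φ := by
  obtain ⟨Ψ, hΨ, hΨc⟩ := exists_derivCocycle X N σ n y
  -- the descent datum at `σ` is `−σ a` ([PerrinRiou98] §3.1.2)
  have hwσ : ∀ u : N, X.ρ σ (Ψ.1 (subgroupConj N σ u)) - Ψ.1 u =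
      X.ρ (u : G) (-(X.ρ σ a)) - -(X.ρ σ a) :=
    rho_apply_deriv_sub_eq X N σ hσn hnX y a hcor (by rw [hyσ, hσ, sub_self]) Ψ hΨ
  -- hence the class of `Ψ` is `σ`-invariant, hence `G`-invariant
  have hinvσ : conjMap X N σ 1 (oneCocycleClass _ Ψ) = oneCocycleClass _ Ψ := by
    rw [conjMap_oneCocycleClass, ← sub_eq_zero, ← oneCocycleClass_sub, oneCocycleClass_eq_zero_iff]
    exact ⟨-(X.ρ σ a), fun u => by
      rw [Submodule.coe_sub, ContinuousMap.sub_apply, conj_pullback_apply]; exact hwσ u⟩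
  have hinv : ∀ g : G, conjMap X N g 1 (oneCocycleClass _ Ψ) = oneCocycleClass _ Ψ :=
    forall_conjMap_eq_of_conjMap_eq X N hgen _ hinvσ
  -- descend on the nose
  obtain ⟨Φ, hΦN, -⟩ := exists_extend_of_forall_conjMap_eq X N hN h0 Ψ hinv
  have hΦσ : Φ.1 σ = -a :=
    apply_eq_neg_of_norm_eq_coboundary X N σ hσ hσn hnX h0 y a hcor hyσ Ψ hΨ Φ hΦN
  have hres : resSubgroup X N 1 (oneCocycleClass X Φ) = oneCocycleClass _ Ψ :=
    resSubgroup_oneCocycleClass_eq_of_extend X N Φ Ψ hΦN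
  refine ⟨Φ, fun u => by rw [hΦN, hΨ], hΦσ, by rw [hres, hΨc], fun κ hκ => ?_⟩
  obtain ⟨x, -, huniq⟩ := existsUnique_resSubgroup_eq_of_forall_conjMap_eq X N hN h0 _ hinv
  rw [← hΨc] at hκ
  exact (huniq κ hκ).trans (huniq _ hres).symm

/-- **The Kolyvagin class, class level** (existence and uniqueness only): under the hypotheses of
`exists_kolyvaginCocycle` stated on the CLASS `ξ = [y]` (`Σ_{i<n} σ^i·ξ = 0`, and `y(σ^n) = 0` for
one — hence every — cocycle `y` of `ξ`, as `σ^n` acts trivially), there is a unique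
`κ ∈ H¹(G, X)` with `res κ = Σ_{i<n} i • σ^i·ξ`. [cite: Rubin2000, Def. 4.4.4 and Lemma 4.4.2] -/
theorem existsUnique_kolyvaginClass (hN : IsOpen (N : Set G))
    (h0 : ∀ v : X, (∀ u : N, X.ρ (u : G) v = v) → v = 0)
    {σ : G} (hσ : ∀ w : X, X.ρ σ w = w) {n : ℕ} (hσn : σ ^ n ∈ N)
    (hgen : ∀ g : G, ∃ i : ℕ, (σ ^ i)⁻¹ * g ∈ N) (hnX : ∀ w : X, (n : ℤ) • w = 0)
    (y : contOneCocycles (subgroupRep X N)) (hyσ : y.1 ⟨σ ^ n, hσn⟩ = 0)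
    (h𝒩 : ∑ i ∈ range n, conjMap X N (σ ^ i) 1 (oneCocycleClass _ y) = 0) :
    ∃! κ : continuousCohomology 1 X,
      resSubgroup X N 1 κ = ∑ i ∈ range n, i • conjMap X N (σ ^ i) 1 (oneCocycleClass _ y) := by
  obtain ⟨a, hcor⟩ := exists_norm_witness_of_sum_conjMap_eq_zero X N σ n y h𝒩
  obtain ⟨Φ, -, -, hres, huniq⟩ := exists_kolyvaginCocycle X N hN h0 hσ hσn hgen hnX y hyσ a hcor
  exact ⟨oneCocycleClass X Φ, hres, huniq⟩

/-! ### §4 Transversality data of the Kolyvagin cocycle -/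

/-- **Value of the derivative cocycle at a Frobenius** (the memo's `κ̃(Fr) = C(n,2)·t_q`): if `σ`
acts trivially on `X` and `y` kills every commutator `Fr⁻¹ σ^{-i} Fr σ^i` (inertial elements of `N`
on which the unramified `y` vanishes), then `Φ(Fr) = (Σ_{i<n} i) • y(Fr)` for any `Φ` extending
the derivative cocycle; in the application `Σ_{i<n} i = n(n−1)/2` kills `X` (`p` odd, `p ∣ n`).
[cite: PerrinRiou1998AIF, Prop. 3.1.6] -/
theorem derivCocycle_apply_eq_sum_smul {σ : G} (hσ : ∀ w : X, X.ρ σ w = w) (n : ℕ)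
    (y : contOneCocycles (subgroupRep X N)) (Φ : contOneCocycles X)
    (hΦ : ∀ u : N, Φ.1 u = ∑ i ∈ range n, (i : ℤ) • X.ρ (σ ^ i) (y.1 (subgroupConj N (σ ^ i) u)))
    (φ : N) (hkill : ∀ i : ℕ, y.1 (φ⁻¹ * subgroupConj N (σ ^ i) φ) = 0) :
    Φ.1 φ = (∑ i ∈ range n, (i : ℤ)) • y.1 φ := by
  rw [hΦ, sum_smul]
  refine sum_congr rfl fun i _ => ?_
  have hmul : subgroupConj N (σ ^ i) φ = φ * (φ⁻¹ * subgroupConj N (σ ^ i) φ) := by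
    rw [mul_inv_cancel_left]
  rw [hmul, subgroup_cocycle_mul, hkill i, map_zero, add_zero, rho_pow_apply_of_rho_eq X hσ]

/-- **The derivative cocycle vanishes where all `σ`-conjugates of `y` do** (the memo's
`κ̃(τ) = 0` for `τ ∈ ℐ ∩ H`: the conjugates `σ^{-i} τ σ^i` stay in `ℐ ∩ H`, where `y` vanishes).
[cite: PerrinRiou1998AIF, §3.1.2] -/
theorem derivCocycle_apply_eq_zero (σ : G) (n : ℕ) (y : contOneCocycles (subgroupRep X N))
    (Φ : contOneCocycles X)
    (hΦ : ∀ u : N, Φ.1 u = ∑ i ∈ range n, (i : ℤ) • X.ρ (σ ^ i) (y.1 (subgroupConj N (σ ^ i) u)))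
    (τ : N) (hτ : ∀ i : ℕ, y.1 (subgroupConj N (σ ^ i) τ) = 0) : Φ.1 τ = 0 := by
  rw [hΦ]
  exact sum_eq_zero fun i _ => by rw [hτ i, map_zero, smul_zero]

omit [IsTopologicalGroup G] [N.Normal] in
/-- **A cocycle vanishing on a set vanishes on the subgroup it generates** (cocycle identity:
`Φ(gh) = Φ(g) + gΦ(h)`, `Φ(g⁻¹) = −g⁻¹Φ(g)`). [cite: SerreGaloisCohomology1997, I §5.1] -/
theorem apply_eq_zero_of_mem_closure (Φ : contOneCocycles X) (S : Set G)
    (hS : ∀ s ∈ S, Φ.1 s = 0) {g : G} (hg : g ∈ Subgroup.closure S) : Φ.1 g = 0 := by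
  induction hg using Subgroup.closure_induction with
  | mem x hx => exact hS x hx
  | one => exact contOneCocycles.apply_one Φ
  | mul x z _ _ hx hz => rw [Φ.2, hx, hz, map_zero, add_zero]
  | inv x _ hx => rw [contOneCocycles.apply_inv, hx, map_zero, neg_zero]

omit [N.Normal] in
/-- **… and on its closure** (continuity; `X` with closed points). For the decomposition group
`𝒟 ∩ G_K` topologically generated by `ℐ ∩ G_K` and a Frobenius this gives `Φ|_{𝒟∩G_K} = 0`.
[cite: SerreGaloisCohomology1997, I §2.2] -/
theorem apply_eq_zero_of_mem_topologicalClosure [T1Space X] (Φ : contOneCocycles X)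
    (H : Subgroup G) (hH : ∀ h ∈ H, Φ.1 h = 0) {g : G} (hg : g ∈ H.topologicalClosure) :
    Φ.1 g = 0 := by
  have hclosed : IsClosed {x : G | Φ.1 x = 0} := isClosed_singleton.preimage Φ.1.continuous
  exact hclosed.closure_subset_iff.mpr (fun h hh => hH h hh) hg

omit [N.Normal] in
/-- **A cocycle vanishing identically on a subgroup has class restricting to zero there**
(`res_D [Φ] = 0`: with `D = 𝒟_𝔔 ∩ G_K` this is "`loc_q κ_q` is TRANSVERSE").
[cite: SerreGaloisCohomology1997, I §2.6 (b)] -/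
theorem resSubgroup_eq_zero_of_forall_apply_eq_zero (D : Subgroup G) (Φ : contOneCocycles X)
    (h : ∀ d ∈ D, Φ.1 d = 0) : resSubgroup X D 1 (oneCocycleClass X Φ) = 0 :=
  resSubgroup_oneCocycleClass_eq_zero_of_forall X D Φ 0 fun d hd => by
    rw [h d hd, map_zero, sub_zero]

omit [N.Normal] in
/-- **Unramified classes have cocycles vanishing identically on the inertia**: if `I ≤ G` acts
trivially on `X` and `res_{N ⊓ I} [y] = 0` (the class of `y` is unramified at the prime of `I` — the
tree's `Kato2004.integralH1` condition), then `y(τ) = 0` for every `τ ∈ N ∩ I` (a coboundary `∂t`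
on a trivially acting group is zero).  Supplies `hyσ`, `hkill`, `hτ` above.
[cite: SerreGaloisCohomology1997, I §5.1] -/
theorem apply_eq_zero_of_resLe_inf_eq_zero (I : Subgroup G) (hI : ∀ τ ∈ I, ∀ w : X, X.ρ τ w = w)
    (y : contOneCocycles (subgroupRep X N))
    (hres : resLe X (inf_le_left : N ⊓ I ≤ N) 1 (oneCocycleClass _ y) = 0)
    (τ : N) (hτ : (τ : G) ∈ I) : y.1 τ = 0 := by
  rw [resLe_oneCocycleClass, oneCocycleClass_eq_zero_iff] at hres
  obtain ⟨t, ht⟩ := hres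
  have h := ht ⟨(τ : G), ⟨τ.2, hτ⟩⟩
  rw [contOneCocycles.pullback_apply, subgroupRep_ρ_apply] at h
  change y.1 ⟨(τ : G), τ.2⟩ = X.ρ (τ : G) t - t at h
  rw [hI _ hτ, sub_self] at h
  exact h

/-! ### §5 The key relation at a Frobenius, and change of coefficients -/

/-- **MU-TRANSFER-PROOF §3 (3.1) at `h = Fr`** (cocycle currency; [PerrinRiou98] Prop. 3.1.6):
if `Σ_{i<n} σ^i y(σ^{-i} u σ^i) = w(u) + (u a − a)` on `N` (the normalised norm relation,
`w = P·φ_1|_N`) and the Frobenius `φ ∈ N` is normalised by `σ` up to elements killed by `y`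
(`y(φ⁻¹ σ^{-i} φ σ^i) = 0`: inertial commutators), then **`(ρ(φ) − 1) a = n • y(φ) − w(φ)`** —
with `n·X = 0` this is the memo's `(φ̃ − 1) t_N = −P·t_1`, the input of the division step
`t_N = −u_P φ̃⁻¹Q(φ̃⁻¹)·t_1`. [cite: PerrinRiou1998AIF, Prop. 3.1.6] -/
theorem rho_sub_eq_of_norm_witness {σ : G} (hσ : ∀ w : X, X.ρ σ w = w) (n : ℕ)
    (y : contOneCocycles (subgroupRep X N)) (w : N → X) (a : X)
    (hcor : ∀ u : N, ∑ i ∈ range n, X.ρ (σ ^ i) (y.1 (subgroupConj N (σ ^ i) u)) =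
      w u + (X.ρ (u : G) a - a))
    (φ : N) (hkill : ∀ i : ℕ, y.1 (φ⁻¹ * subgroupConj N (σ ^ i) φ) = 0) :
    X.ρ (φ : G) a - a = n • y.1 φ - w φ := by
  have h := hcor φ
  rw [sum_rho_pow_apply_subgroupConj_eq_nsmul X N σ hσ n y φ hkill] at h
  rw [h]
  abel

variable {X' : TopRep.{u} R G}

/-- **Norm witnesses push forward along an equivariant coefficient map** `π : X' ⟶ X` (the
truncation `𝒯_{J'} → 𝒯_J`): if `Σ σ^i y'(σ^{-i}uσ^i) = w'(u) + (u a' − a')` on `N` for an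
`X'`-valued cocycle `y'`, then the same holds for `π ∘ y'` with `π ∘ w'` and `π a'`; when `π` kills
`w'` (the Euler factor `P ∈ T^{2e}Ω` dies modulo `T^{2e}`) the pushed-forward witness is a norm
witness ON THE NOSE (`𝒩(π∘y') = ∂(π a')`), the input of `exists_kolyvaginCocycle`.
[cite: Rubin2000, Lemma 4.4.2 (proof)] -/
theorem norm_witness_map (π : X' ⟶ X) (σ : G) (n : ℕ)
    (y' : contOneCocycles (subgroupRep X' N)) (w' : N → X') (a' : X')
    (hcor : ∀ u : N, ∑ i ∈ range n, X'.ρ (σ ^ i) (y'.1 (subgroupConj N (σ ^ i) u)) =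
      w' u + (X'.ρ (u : G) a' - a')) (u : N) :
    ∑ i ∈ range n, X.ρ (σ ^ i)
        ((contOneCocycles.pullback (ContinuousMonoidHom.id N)
          (Y := subgroupRep X N)
          (TopRep.ofHom ⟨π.hom.toContinuousLinearMap, fun g =>
            π.hom.isIntertwining' (g : G)⟩) y').1 (subgroupConj N (σ ^ i) u)) =
      π.hom (w' u) + (X.ρ (u : G) (π.hom a') - π.hom a') := by
  have hπρ : ∀ (g : G) (x : X'), π.hom (X'.ρ g x) = X.ρ g (π.hom x) := fun g x =>
    TopRep.hom_comm_apply π g x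
  have h := congrArg π.hom (hcor u)
  rw [map_sum, map_add, map_sub] at h
  simp_rw [hπρ] at h
  rw [← h]
  refine sum_congr rfl fun i _ => ?_
  rfl

end Summit.BirchSwinnertonDyer.BirchSwinnertonDyer.Rank1Residual.KolyvaginTwist

end
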